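import Summits.Parity.GeneralizedHardyLittlewood.Theorems.FordMaynardNoSieveConst0164NegWitness0164Witness
import Mathlib.Analysis.SpecialFunctions.Integrals.Basic

/-!
# Route `FordMaynardNoSieveConst0164`, crux `NegWitness0164` (stmt-Parity-19102), line `birth`,
# stub `stub_tweakNeg0164`: the two-dimensional kernel in closed form (Ford–Maynard's `F₄(α)` exactly)

Helper file toward the certificate stub (K. Ford, J. Maynard, *On the theory of prime producing sieves*,
arXiv:2407.14368, §8: "`F₄(α) = α∫_{ν ≤ β₃ ≤ β₄ ≤ 1/2, β₃+β₄ = α} 1/(β₃β₄) = log(α/max(ν, α−1/2) − 1)`").  The right-hand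
side of inequality (II) of `stub_tweakNeg0164_of_table` (`…Witness`) and the inner integral of `J₃` in (I) are the slice
integral `∫_{v ∈ Δ₂(α)} 𝟙[a < v₀ < b]/(v₀v₁)` for suitable windows `(a, b)`; here it is evaluated in closed form for
every total `α` (the tree's `sliceIntegral_two_indicator_div_mul` is the case `α = 1`):

* `sliceIntegral_two_eq_intervalIntegral` — `∫_{Δ₂(α)} G = ∫_{t ∈ (0, α)} G(t, α − t) dt` (projection measure);
* `integral_inv_mul_inv_sub_0164` — `∫_a^b dt/(t(α−t)) = (log(b/(α−b)) − log(a/(α−a)))/α` for `0 < a ≤ b < α`;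
* `kernel_two_window_eq_log` — `∫_{Δ₂(α)} 𝟙[a < v₀ < b]/(v₀v₁) = (log(b/(α−b)) − log(a/(α−a)))/α`;
* `K3_eq_log_upper_0164` — the kernel `𝟙[ν ≤ vᵢ < 1/2]/(v₀v₁)` of (II) in closed form for `α ≥ 1/2 + ν`
  (`= (2/α) log((1/2)/(α−1/2))`), `K3_eq_log_lower_0164` — the window-`(ν, α−ν)` value (`= (2/α) log((α−ν)/ν)`).

Def-free.  References: [FordMaynard2024PrimeSieves] arXiv:2407.14368, §4.2 (projection measure), §8 (F₃, F₄).
-/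

noncomputable section

open Finset MeasureTheory Set intervalIntegral
open scoped Classical
open Literature.NumberTheory.Sieve Literature.NumberTheory.Sieve.FordMaynard

namespace Summit.Parity.GeneralizedHardyLittlewood.FordMaynardNoSieveConst0164NegWitness0164

/-- **Dimension two: the slice integral is an interval integral**: `∫_{Δ₂(α)} G = ∫_{t ∈ (0,α)} G(t, α−t) dt`.
[cite: FordMaynard2024PrimeSieves, §4.2 (Notational convention)] -/
theorem sliceIntegral_two_eq_intervalIntegral (α : ℝ) (G : (Fin 2 → ℝ) → ℝ) :
    sliceIntegral 2 α G = ∫ t in Ioo 0 α, G ![t, α - t] := by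
  rw [sliceIntegral_succ_eq]
  set g : ℝ → ℝ := fun t => if 0 < t ∧ t < α then G ![t, α - t] else 0 with hg
  have hcomp : (fun u : Fin 1 → ℝ => sliceIntegrand 1 α G u) =
      fun u => g (MeasurableEquiv.funUnique (Fin 1) ℝ u) := by
    funext u
    have h0 : (MeasurableEquiv.funUnique (Fin 1) ℝ u : ℝ) = u 0 := rfl
    unfold sliceIntegrand
    simp only [hg, h0, Fin.sum_univ_one, snoc_fin_one_eq]
    have hiff : (∀ i : Fin 1, 0 < u i) ↔ 0 < u 0 :=
      ⟨fun h => h 0, fun h i => by rw [Subsingleton.elim i 0]; exact h⟩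
    simp only [hiff]
  rw [hcomp]
  refine ((volume_preserving_funUnique (Fin 1) ℝ).integral_comp'
    (f := MeasurableEquiv.funUnique (Fin 1) ℝ) g).trans ?_
  have hind : g = (Ioo 0 α).indicator fun t => G ![t, α - t] := by
    funext t
    simp only [hg, Set.indicator_apply, Set.mem_Ioo]
  rw [hind, MeasureTheory.integral_indicator measurableSet_Ioo]

/-- The antiderivative of `1/(t(α−t))` on `(0, α)`: `d/dt (log t − log(α−t)) = α/(t(α−t))`. [folklore] -/
theorem hasDerivAt_log_sub_log_sub_0164 {α t : ℝ} (ht0 : 0 < t) (ht1 : t < α) :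
    HasDerivAt (fun x => Real.log x - Real.log (α - x)) (α / (t * (α - t))) t := by
  have ht0' : t ≠ 0 := ht0.ne'
  have ht1' : α - t ≠ 0 := by linarith
  have h1 : HasDerivAt (fun x : ℝ => Real.log x) t⁻¹ t := Real.hasDerivAt_log ht0'
  have h2 : HasDerivAt (fun x : ℝ => Real.log (α - x)) (-1 / (α - t)) t :=
    ((hasDerivAt_id' t).const_sub α).log ht1'
  have h := h1.sub h2
  refine h.congr_deriv ?_
  field_simp
  ring

/-- **`∫_a^b dt/(t(α−t)) = (log(b/(α−b)) − log(a/(α−a)))/α`** for `0 < a ≤ b < α`. [folklore] -/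
theorem integral_inv_mul_inv_sub_0164 {α a b : ℝ} (ha : 0 < a) (hab : a ≤ b) (hb : b < α) :
    ∫ t in a..b, 1 / (t * (α - t)) =
      (Real.log (b / (α - b)) - Real.log (a / (α - a))) / α := by
  have hα : 0 < α := by linarith
  have hcont : ContinuousOn (fun t : ℝ => α / (t * (α - t))) (uIcc a b) := by
    refine continuousOn_const.div (continuousOn_id.mul (continuousOn_const.sub continuousOn_id))
      fun t ht => ?_
    rw [uIcc_of_le hab] at ht
    have h0 : 0 < t := ha.trans_le ht.1
    have h1' : t < α := ht.2.trans_lt hb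
    exact mul_ne_zero h0.ne' (by linarith)
  have hmain : ∫ t in a..b, α / (t * (α - t)) =
      (Real.log b - Real.log (α - b)) - (Real.log a - Real.log (α - a)) := by
    rw [intervalIntegral.integral_eq_sub_of_hasDerivAt (f := fun x => Real.log x - Real.log (α - x))
      (fun t ht => by
        rw [uIcc_of_le hab] at ht
        exact hasDerivAt_log_sub_log_sub_0164 (ha.trans_le ht.1) (ht.2.trans_lt hb))
      (hcont.intervalIntegrable)]
  have hscale : (fun t : ℝ => 1 / (t * (α - t))) = fun t => α⁻¹ * (α / (t * (α - t))) := by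
    funext t
    by_cases h : t * (α - t) = 0
    · rw [h]; simp
    · field_simp
  rw [hscale, intervalIntegral.integral_const_mul, hmain]
  have ha1 : 0 < α - a := by linarith
  have hb0 : 0 < b := ha.trans_le hab
  have hb1 : 0 < α - b := by linarith
  rw [Real.log_div hb0.ne' hb1.ne', Real.log_div ha.ne' ha1.ne']
  field_simp

/-- **The two-dimensional kernel over a window, in closed form**: for `0 < a ≤ b < α`,
`∫_{v ∈ Δ₂(α)} 𝟙[a < v₀ < b]/(v₀v₁) dv = (log(b/(α−b)) − log(a/(α−a)))/α`
(Ford–Maynard's `F₃(α) = F₄(α) = log(α/max(ν, α−1/2) − 1)` are `(α/2)·` this with the window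
`(max(ν, α−1/2), min(1/2, α−ν))`). [cite: FordMaynard2024PrimeSieves, §8 (F₃, F₄)] -/
theorem kernel_two_window_eq_log {α a b : ℝ} (ha : 0 < a) (hab : a ≤ b) (hb : b < α) :
    sliceIntegral 2 α (fun v => if a < v 0 ∧ v 0 < b then 1 / (v 0 * v 1) else 0) =
      (Real.log (b / (α - b)) - Real.log (a / (α - a))) / α := by
  rw [sliceIntegral_two_eq_intervalIntegral]
  simp only [Matrix.cons_val_zero, Matrix.cons_val_one]
  have hsub : Ioo a b ⊆ Ioo (0:ℝ) α := fun t ht => ⟨ha.trans ht.1, ht.2.trans hb⟩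
  have h1 : (∫ t in Ioo (0:ℝ) α, if a < t ∧ t < b then 1 / (t * (α - t)) else 0) =
      ∫ t in Ioo a b, 1 / (t * (α - t)) := by
    have hind : (fun t : ℝ => if a < t ∧ t < b then 1 / (t * (α - t)) else 0) =
        (Ioo a b).indicator fun t => 1 / (t * (α - t)) := by
      funext t
      simp only [Set.indicator_apply, Set.mem_Ioo]
    rw [hind, setIntegral_indicator measurableSet_Ioo, Set.inter_eq_self_of_subset_right hsub]
  rw [h1, ← integral_Ioc_eq_integral_Ioo, ← intervalIntegral.integral_of_le hab,
    integral_inv_mul_inv_sub_0164 ha hab hb]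

/-- **Ford–Maynard's `F₄(α)` (= `F₃(α)`), upper range**: for `1/2 + ν ≤ α ≤ 1` (`ν = 41/250`),
`∫_{Δ₂(α)} 𝟙[ν ≤ vᵢ < 1/2]/(v₀v₁) = (2/α)·log((1/2)/(α − 1/2))` (window `v₀ ∈ (α − 1/2, 1/2)`).
[cite: FordMaynard2024PrimeSieves, §8 ("F₄(α) = log(α/max(ν,α−1/2) − 1)")] -/
theorem K3_eq_log_upper_0164 {α : ℝ} (hα : 1 / 2 + 41 / 250 ≤ α) (hα1 : α ≤ 1) :
    sliceIntegral 2 α (fun v => if (∀ i, (41 / 250 : ℝ) ≤ v i) ∧ (∀ i, v i < 1 / 2) then 1 / (v 0 * v 1) else 0) =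
      (Real.log ((1 / 2) / (α - 1 / 2)) - Real.log ((α - 1 / 2) / (α - (α - 1 / 2)))) / α := by
  rw [← kernel_two_window_eq_log (by linarith) (by linarith) (by linarith)]
  refine sliceIntegral_congr fun v hv hvs => ?_
  rw [Fin.sum_univ_two] at hvs
  have hiff : ((∀ i, (41 / 250 : ℝ) ≤ v i) ∧ (∀ i, v i < 1 / 2)) ↔ (α - 1 / 2 < v 0 ∧ v 0 < 1 / 2) := by
    simp only [Fin.forall_fin_two]
    constructor
    · rintro ⟨⟨h0, h1⟩, ⟨h2, h3⟩⟩; exact ⟨by linarith, h2⟩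
    · rintro ⟨h0, h1⟩; exact ⟨⟨by linarith, by linarith⟩, ⟨h1, by linarith⟩⟩
  simp only [hiff]

/-- **Ford–Maynard's `F₄(α)` (= `F₃(α)`), lower range**: for `2ν < α` (`ν = 41/250`) the window-`(ν, α−ν)` kernel is
`(log((α−ν)/ν) − log(ν/(α−ν)))/α = (2/α) log((α−ν)/ν)` (for `α ≤ 1/2 + ν` this window is the support of
`𝟙[ν ≤ vᵢ < 1/2]` up to the null set `{v₀ = ν}`). [cite: FordMaynard2024PrimeSieves, §8 (F₄, case α < 1/2+ν)] -/
theorem K3_eq_log_lower_0164 {α : ℝ} (hα : 2 * (41 / 250) < α) :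
    sliceIntegral 2 α (fun v => if (41 / 250 : ℝ) < v 0 ∧ v 0 < α - 41 / 250 then 1 / (v 0 * v 1) else 0) =
      (Real.log ((α - 41 / 250) / (α - (α - 41 / 250))) - Real.log ((41 / 250) / (α - 41 / 250))) / α :=
  kernel_two_window_eq_log (by norm_num) (by linarith) (by linarith)

end Summit.Parity.GeneralizedHardyLittlewood.FordMaynardNoSieveConst0164NegWitness0164

end
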